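import Mathlib

/-!
# ValiantsHypothesis / RigidityForcesSymmetry — crux `LaplaceOptimalFive` (stmt-ValiantsHypothesis-24813), crux idea
`young-shadow` (K1, the side-symmetric sector), sketch `Cruxes/LaplaceOptimalFive/YoungShadowSketch.lean` §2:
THREE-SPLIT SEPARATION for the TRIANGLE `{0,1}, {0,2}, {1,2}`.

If `Z_A + Z_B + Z_C` is fully slot-symmetric and `Z_A, Z_B, Z_C` are side-symmetric for the pair splits `A = {0,1}`,
`B = {0,2}`, `C = {1,2}`, then each of them is fully slot-symmetric.  This is the TRIANGLE orbit type of the sketch's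
`stub_threeSplit_separation` (the type of the weight-108 LM-tail profile `3·01 + 3·02 + 3·12`), at the normalized slots;
the statement is the stub's with `S₁ S₂ S₃ := {0,1} {0,2} {1,2}` and `SlotInvariantOn` UNFOLDED.

Proof (elementary, no representation theory).  (1) The swap `(1 2) ∈ G_C` exchanges the splits `A` and `B`, so
`c₁ := (1 2)·Z_A − Z_B` is invariant under both Young groups `G_A`, `G_B`, hence under `S₅` (two distinct pair splits
generate); likewise `c₂ := (0 2)·Z_A − Z_C`.  (2) Hence `Q := Z_A + (1 2)·Z_A + (0 2)·Z_A` is fully symmetric.  (3) Writing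
`W_P := π_P·Z_A` for the transport of `Z_A` to the pair `P` (`π_P(A) = P`; well defined up to `G_A`), `Q = W_A + W_B + W_C`
and symmetry gives `W_P + W_P' + W_P'' = Q` for the triangles `{0,1,3}, {0,1,4}, {1,2,3}, {1,2,4}, {0,3,4}, {2,3,4}`; the
alternating combination of these six yields `W_A = W_C = (0 2)·Z_A`, i.e. `Z_A` is `(0 2)`-invariant, hence fully symmetric
(`(0 1), (0 2), (2 3), (2 4), (3 4)` connect all slots); then `Z_B = (1 2)·Z_A − c₁` and `Z_C = (0 2)·Z_A − c₂` are too.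

Honest framing.  One orbit type (of four) of `stub_threeSplit_separation`, at normalized slots; K1 `SideSymLO5`, Prop A,
`LaplaceOptimalFive` (stmt-24813, OPEN · CONTESTED 72/120), `RankRigidMinimalRepr` and `VP ≠ VNP` are NOT proved here.
No definitions, no `sorry`; Mathlib only (permutation identities by `decide`).
-/

set_option linter.dupNamespace false

namespace Summit.ValiantsHypothesis.ValiantsHypothesis.Theorems.RigidityForcesSymmetryRankRigidMinimalRepr

namespace LaplaceFiveTriangleSeparation

open Finset

/-- Invariance under two slot permutations gives invariance under their product. [folklore] -/
theorem inv_mul (Z : (Fin 5 → Fin 5) → ℂ) {s t : Equiv.Perm (Fin 5)} (hs : ∀ v : Fin 5 → Fin 5, Z (v ∘ ⇑s) = Z v)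
    (ht : ∀ v : Fin 5 → Fin 5, Z (v ∘ ⇑t) = Z v) : ∀ v : Fin 5 → Fin 5, Z (v ∘ ⇑(s * t)) = Z v := by
  intro v
  rw [Equiv.Perm.coe_mul, ← Function.comp_assoc, ht, hs]

/-- A swap inside `P` fixes the slots outside `P`. [folklore] -/
theorem swap_fixes_outside (P : Finset (Fin 5)) {a b : Fin 5} (ha : a ∈ P) (hb : b ∈ P) :
    ∀ i, i ∉ P → Equiv.swap a b i = i :=
  fun _ hi => Equiv.swap_apply_of_ne_of_ne (fun h => hi (h ▸ ha)) (fun h => hi (h ▸ hb))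

/-- Invariance under the swaps `(0 1), (0 2), (2 3), (2 4), (3 4)` (a connected set of transpositions) is full slot
symmetry. [folklore] -/
theorem full_of_five_swaps (Z : (Fin 5 → Fin 5) → ℂ)
    (h01 : ∀ v : Fin 5 → Fin 5, Z (v ∘ ⇑(Equiv.swap (0 : Fin 5) 1)) = Z v)
    (h02 : ∀ v : Fin 5 → Fin 5, Z (v ∘ ⇑(Equiv.swap (0 : Fin 5) 2)) = Z v)
    (h23 : ∀ v : Fin 5 → Fin 5, Z (v ∘ ⇑(Equiv.swap (2 : Fin 5) 3)) = Z v)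
    (h24 : ∀ v : Fin 5 → Fin 5, Z (v ∘ ⇑(Equiv.swap (2 : Fin 5) 4)) = Z v)
    (h34 : ∀ v : Fin 5 → Fin 5, Z (v ∘ ⇑(Equiv.swap (3 : Fin 5) 4)) = Z v) :
    ∀ τ : Equiv.Perm (Fin 5), ∀ v : Fin 5 → Fin 5, Z (v ∘ ⇑τ) = Z v := by
  have h12 : ∀ v : Fin 5 → Fin 5, Z (v ∘ ⇑(Equiv.swap (1 : Fin 5) 2)) = Z v := by
    rw [show Equiv.swap (1 : Fin 5) 2 = Equiv.swap 0 1 * Equiv.swap 0 2 * Equiv.swap 0 1 from by decide]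
    exact inv_mul Z (inv_mul Z h01 h02) h01
  have h03 : ∀ v : Fin 5 → Fin 5, Z (v ∘ ⇑(Equiv.swap (0 : Fin 5) 3)) = Z v := by
    rw [show Equiv.swap (0 : Fin 5) 3 = Equiv.swap 2 3 * Equiv.swap 0 2 * Equiv.swap 2 3 from by decide]
    exact inv_mul Z (inv_mul Z h23 h02) h23
  have h04 : ∀ v : Fin 5 → Fin 5, Z (v ∘ ⇑(Equiv.swap (0 : Fin 5) 4)) = Z v := by
    rw [show Equiv.swap (0 : Fin 5) 4 = Equiv.swap 2 4 * Equiv.swap 0 2 * Equiv.swap 2 4 from by decide]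
    exact inv_mul Z (inv_mul Z h24 h02) h24
  have h13 : ∀ v : Fin 5 → Fin 5, Z (v ∘ ⇑(Equiv.swap (1 : Fin 5) 3)) = Z v := by
    rw [show Equiv.swap (1 : Fin 5) 3 = Equiv.swap 0 1 * Equiv.swap 0 3 * Equiv.swap 0 1 from by decide]
    exact inv_mul Z (inv_mul Z h01 h03) h01
  have h14 : ∀ v : Fin 5 → Fin 5, Z (v ∘ ⇑(Equiv.swap (1 : Fin 5) 4)) = Z v := by
    rw [show Equiv.swap (1 : Fin 5) 4 = Equiv.swap 0 1 * Equiv.swap 0 4 * Equiv.swap 0 1 from by decide]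
    exact inv_mul Z (inv_mul Z h01 h04) h01
  have hall : ∀ x y : Fin 5, x ≠ y → ∀ v : Fin 5 → Fin 5, Z (v ∘ ⇑(Equiv.swap x y)) = Z v := by
    intro x y hxy
    fin_cases x <;> fin_cases y
    all_goals first
      | exact absurd rfl hxy
      | exact h01 | exact h02 | exact h03 | exact h04 | exact h12 | exact h13 | exact h14 | exact h23 | exact h24
      | exact h34
      | (rw [Equiv.swap_comm]; first
          | exact h01 | exact h02 | exact h03 | exact h04 | exact h12 | exact h13 | exact h14 | exact h23
          | exact h24 | exact h34)
  intro τ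
  induction τ using Equiv.Perm.swap_induction_on with
  | one => intro v; simp
  | swap_mul f x y hxy ih => exact inv_mul Z (hall x y hxy) ih

/-- **Three-split separation, triangle type** (`stub_threeSplit_separation` at `S₁ S₂ S₃ := {0,1} {0,2} {1,2}`,
`SlotInvariantOn` unfolded): a fully slot-symmetric sum of three shadows, side-symmetric for the pair splits
`{0,1}`, `{0,2}`, `{1,2}`, has fully slot-symmetric summands. [folklore] -/
theorem threeSplit_separation_triangle (ZA ZB ZC : (Fin 5 → Fin 5) → ℂ)
    (hZA : (∀ τ : Equiv.Perm (Fin 5), (∀ i, i ∉ ({0, 1} : Finset (Fin 5)) → τ i = i) →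
        ∀ v : Fin 5 → Fin 5, ZA (v ∘ ⇑τ) = ZA v) ∧
      (∀ τ : Equiv.Perm (Fin 5), (∀ i, i ∉ ({0, 1} : Finset (Fin 5))ᶜ → τ i = i) →
        ∀ v : Fin 5 → Fin 5, ZA (v ∘ ⇑τ) = ZA v))
    (hZB : (∀ τ : Equiv.Perm (Fin 5), (∀ i, i ∉ ({0, 2} : Finset (Fin 5)) → τ i = i) →
        ∀ v : Fin 5 → Fin 5, ZB (v ∘ ⇑τ) = ZB v) ∧
      (∀ τ : Equiv.Perm (Fin 5), (∀ i, i ∉ ({0, 2} : Finset (Fin 5))ᶜ → τ i = i) →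
        ∀ v : Fin 5 → Fin 5, ZB (v ∘ ⇑τ) = ZB v))
    (hZC : (∀ τ : Equiv.Perm (Fin 5), (∀ i, i ∉ ({1, 2} : Finset (Fin 5)) → τ i = i) →
        ∀ v : Fin 5 → Fin 5, ZC (v ∘ ⇑τ) = ZC v) ∧
      (∀ τ : Equiv.Perm (Fin 5), (∀ i, i ∉ ({1, 2} : Finset (Fin 5))ᶜ → τ i = i) →
        ∀ v : Fin 5 → Fin 5, ZC (v ∘ ⇑τ) = ZC v))
    (hsum : ∀ τ : Equiv.Perm (Fin 5), (∀ i, i ∉ (Finset.univ : Finset (Fin 5)) → τ i = i) →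
      ∀ v : Fin 5 → Fin 5, (ZA + ZB + ZC) (v ∘ ⇑τ) = (ZA + ZB + ZC) v) :
    (∀ τ : Equiv.Perm (Fin 5), (∀ i, i ∉ (Finset.univ : Finset (Fin 5)) → τ i = i) →
        ∀ v : Fin 5 → Fin 5, ZA (v ∘ ⇑τ) = ZA v) ∧
      (∀ τ : Equiv.Perm (Fin 5), (∀ i, i ∉ (Finset.univ : Finset (Fin 5)) → τ i = i) →
        ∀ v : Fin 5 → Fin 5, ZB (v ∘ ⇑τ) = ZB v) ∧
      (∀ τ : Equiv.Perm (Fin 5), (∀ i, i ∉ (Finset.univ : Finset (Fin 5)) → τ i = i) →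
        ∀ v : Fin 5 → Fin 5, ZC (v ∘ ⇑τ) = ZC v) := by
  -- swap invariances of the three shadows
  have a01 := hZA.1 (Equiv.swap 0 1) (swap_fixes_outside {0, 1} (by decide) (by decide))
  have a23 := hZA.2 (Equiv.swap 2 3) (swap_fixes_outside {0, 1}ᶜ (by decide) (by decide))
  have a24 := hZA.2 (Equiv.swap 2 4) (swap_fixes_outside {0, 1}ᶜ (by decide) (by decide))
  have a34 := hZA.2 (Equiv.swap 3 4) (swap_fixes_outside {0, 1}ᶜ (by decide) (by decide))
  have b02 := hZB.1 (Equiv.swap 0 2) (swap_fixes_outside {0, 2} (by decide) (by decide))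
  have b13 := hZB.2 (Equiv.swap 1 3) (swap_fixes_outside {0, 2}ᶜ (by decide) (by decide))
  have b14 := hZB.2 (Equiv.swap 1 4) (swap_fixes_outside {0, 2}ᶜ (by decide) (by decide))
  have b34 := hZB.2 (Equiv.swap 3 4) (swap_fixes_outside {0, 2}ᶜ (by decide) (by decide))
  have c12 := hZC.1 (Equiv.swap 1 2) (swap_fixes_outside {1, 2} (by decide) (by decide))
  have c03 := hZC.2 (Equiv.swap 0 3) (swap_fixes_outside {1, 2}ᶜ (by decide) (by decide))
  have c04 := hZC.2 (Equiv.swap 0 4) (swap_fixes_outside {1, 2}ᶜ (by decide) (by decide))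
  have c34 := hZC.2 (Equiv.swap 3 4) (swap_fixes_outside {1, 2}ᶜ (by decide) (by decide))
  have hS : ∀ (τ : Equiv.Perm (Fin 5)) (v : Fin 5 → Fin 5),
      ZA (v ∘ ⇑τ) + ZB (v ∘ ⇑τ) + ZC (v ∘ ⇑τ) = ZA v + ZB v + ZC v :=
    fun τ v => hsum τ (fun i hi => absurd (Finset.mem_univ i) hi) v

  -- (1) c₁ := (1 2)·ZA − ZB is fully symmetric ((1 2) ∈ G_C exchanges the splits A and B)
  have E1 : ∀ v : Fin 5 → Fin 5, ZA (v ∘ ⇑(Equiv.swap (1 : Fin 5) 2)) + ZB (v ∘ ⇑(Equiv.swap (1 : Fin 5) 2))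
      = ZA v + ZB v := by
    intro v
    have h := hS (Equiv.swap 1 2) v
    rw [c12 v] at h
    linear_combination h
  have c1full : ∀ τ : Equiv.Perm (Fin 5), ∀ v : Fin 5 → Fin 5,
      (fun u => ZA (u ∘ ⇑(Equiv.swap (1 : Fin 5) 2)) - ZB u) (v ∘ ⇑τ)
        = (fun u => ZA (u ∘ ⇑(Equiv.swap (1 : Fin 5) 2)) - ZB u) v := by
    refine full_of_five_swaps (fun u => ZA (u ∘ ⇑(Equiv.swap (1 : Fin 5) 2)) - ZB u) ?_ ?_ ?_ ?_ ?_
    · intro v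
      show ZA ((v ∘ ⇑(Equiv.swap (0 : Fin 5) 1)) ∘ ⇑(Equiv.swap (1 : Fin 5) 2)) - ZB (v ∘ ⇑(Equiv.swap (0 : Fin 5) 1)) = ZA (v ∘ ⇑(Equiv.swap (1 : Fin 5) 2)) - ZB v
      have e1 := E1 v
      have e2 := E1 (v ∘ ⇑(Equiv.swap (0 : Fin 5) 1))
      have hs := a01 v
      have ho : ZB ((v ∘ ⇑(Equiv.swap (0 : Fin 5) 1)) ∘ ⇑(Equiv.swap (1 : Fin 5) 2)) = ZB (v ∘ ⇑(Equiv.swap (1 : Fin 5) 2)) := by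
        rw [Function.comp_assoc, ← Equiv.Perm.coe_mul,
          show Equiv.swap (0 : Fin 5) 1 * Equiv.swap (1 : Fin 5) 2 = Equiv.swap (1 : Fin 5) 2 * Equiv.swap (0 : Fin 5) 2 from by decide,
          Equiv.Perm.coe_mul, ← Function.comp_assoc, b02]
      linear_combination e2 - e1 + hs - ho
    · intro v
      show ZA ((v ∘ ⇑(Equiv.swap (0 : Fin 5) 2)) ∘ ⇑(Equiv.swap (1 : Fin 5) 2)) - ZB (v ∘ ⇑(Equiv.swap (0 : Fin 5) 2)) = ZA (v ∘ ⇑(Equiv.swap (1 : Fin 5) 2)) - ZB v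
      have hs := b02 v
      have ho : ZA ((v ∘ ⇑(Equiv.swap (0 : Fin 5) 2)) ∘ ⇑(Equiv.swap (1 : Fin 5) 2)) = ZA (v ∘ ⇑(Equiv.swap (1 : Fin 5) 2)) := by
        rw [Function.comp_assoc, ← Equiv.Perm.coe_mul,
          show Equiv.swap (0 : Fin 5) 2 * Equiv.swap (1 : Fin 5) 2 = Equiv.swap (1 : Fin 5) 2 * Equiv.swap (0 : Fin 5) 1 from by decide,
          Equiv.Perm.coe_mul, ← Function.comp_assoc, a01]
      linear_combination ho - hs
    · intro v
      show ZA ((v ∘ ⇑(Equiv.swap (2 : Fin 5) 3)) ∘ ⇑(Equiv.swap (1 : Fin 5) 2)) - ZB (v ∘ ⇑(Equiv.swap (2 : Fin 5) 3)) = ZA (v ∘ ⇑(Equiv.swap (1 : Fin 5) 2)) - ZB v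
      have e1 := E1 v
      have e2 := E1 (v ∘ ⇑(Equiv.swap (2 : Fin 5) 3))
      have hs := a23 v
      have ho : ZB ((v ∘ ⇑(Equiv.swap (2 : Fin 5) 3)) ∘ ⇑(Equiv.swap (1 : Fin 5) 2)) = ZB (v ∘ ⇑(Equiv.swap (1 : Fin 5) 2)) := by
        rw [Function.comp_assoc, ← Equiv.Perm.coe_mul,
          show Equiv.swap (2 : Fin 5) 3 * Equiv.swap (1 : Fin 5) 2 = Equiv.swap (1 : Fin 5) 2 * Equiv.swap (1 : Fin 5) 3 from by decide,
          Equiv.Perm.coe_mul, ← Function.comp_assoc, b13]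
      linear_combination e2 - e1 + hs - ho
    · intro v
      show ZA ((v ∘ ⇑(Equiv.swap (2 : Fin 5) 4)) ∘ ⇑(Equiv.swap (1 : Fin 5) 2)) - ZB (v ∘ ⇑(Equiv.swap (2 : Fin 5) 4)) = ZA (v ∘ ⇑(Equiv.swap (1 : Fin 5) 2)) - ZB v
      have e1 := E1 v
      have e2 := E1 (v ∘ ⇑(Equiv.swap (2 : Fin 5) 4))
      have hs := a24 v
      have ho : ZB ((v ∘ ⇑(Equiv.swap (2 : Fin 5) 4)) ∘ ⇑(Equiv.swap (1 : Fin 5) 2)) = ZB (v ∘ ⇑(Equiv.swap (1 : Fin 5) 2)) := by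
        rw [Function.comp_assoc, ← Equiv.Perm.coe_mul,
          show Equiv.swap (2 : Fin 5) 4 * Equiv.swap (1 : Fin 5) 2 = Equiv.swap (1 : Fin 5) 2 * Equiv.swap (1 : Fin 5) 4 from by decide,
          Equiv.Perm.coe_mul, ← Function.comp_assoc, b14]
      linear_combination e2 - e1 + hs - ho
    · intro v
      show ZA ((v ∘ ⇑(Equiv.swap (3 : Fin 5) 4)) ∘ ⇑(Equiv.swap (1 : Fin 5) 2)) - ZB (v ∘ ⇑(Equiv.swap (3 : Fin 5) 4)) = ZA (v ∘ ⇑(Equiv.swap (1 : Fin 5) 2)) - ZB v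
      have hs := b34 v
      have ho : ZA ((v ∘ ⇑(Equiv.swap (3 : Fin 5) 4)) ∘ ⇑(Equiv.swap (1 : Fin 5) 2)) = ZA (v ∘ ⇑(Equiv.swap (1 : Fin 5) 2)) := by
        rw [Function.comp_assoc, ← Equiv.Perm.coe_mul,
          show Equiv.swap (3 : Fin 5) 4 * Equiv.swap (1 : Fin 5) 2 = Equiv.swap (1 : Fin 5) 2 * Equiv.swap (3 : Fin 5) 4 from by decide,
          Equiv.Perm.coe_mul, ← Function.comp_assoc, a34]
      linear_combination ho - hs
  have E2 : ∀ v : Fin 5 → Fin 5, ZA (v ∘ ⇑(Equiv.swap (0 : Fin 5) 2)) + ZC (v ∘ ⇑(Equiv.swap (0 : Fin 5) 2))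
      = ZA v + ZC v := by
    intro v
    have h := hS (Equiv.swap 0 2) v
    rw [b02 v] at h
    linear_combination h
  have c2full : ∀ τ : Equiv.Perm (Fin 5), ∀ v : Fin 5 → Fin 5,
      (fun u => ZA (u ∘ ⇑(Equiv.swap (0 : Fin 5) 2)) - ZC u) (v ∘ ⇑τ)
        = (fun u => ZA (u ∘ ⇑(Equiv.swap (0 : Fin 5) 2)) - ZC u) v := by
    refine full_of_five_swaps (fun u => ZA (u ∘ ⇑(Equiv.swap (0 : Fin 5) 2)) - ZC u) ?_ ?_ ?_ ?_ ?_
    · intro v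
      show ZA ((v ∘ ⇑(Equiv.swap (0 : Fin 5) 1)) ∘ ⇑(Equiv.swap (0 : Fin 5) 2)) - ZC (v ∘ ⇑(Equiv.swap (0 : Fin 5) 1)) = ZA (v ∘ ⇑(Equiv.swap (0 : Fin 5) 2)) - ZC v
      have e1 := E2 v
      have e2 := E2 (v ∘ ⇑(Equiv.swap (0 : Fin 5) 1))
      have hs := a01 v
      have ho : ZC ((v ∘ ⇑(Equiv.swap (0 : Fin 5) 1)) ∘ ⇑(Equiv.swap (0 : Fin 5) 2)) = ZC (v ∘ ⇑(Equiv.swap (0 : Fin 5) 2)) := by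
        rw [Function.comp_assoc, ← Equiv.Perm.coe_mul,
          show Equiv.swap (0 : Fin 5) 1 * Equiv.swap (0 : Fin 5) 2 = Equiv.swap (0 : Fin 5) 2 * Equiv.swap (1 : Fin 5) 2 from by decide,
          Equiv.Perm.coe_mul, ← Function.comp_assoc, c12]
      linear_combination e2 - e1 + hs - ho
    · intro v
      show ZA ((v ∘ ⇑(Equiv.swap (0 : Fin 5) 2)) ∘ ⇑(Equiv.swap (0 : Fin 5) 2)) - ZC (v ∘ ⇑(Equiv.swap (0 : Fin 5) 2)) = ZA (v ∘ ⇑(Equiv.swap (0 : Fin 5) 2)) - ZC v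
      have e1 := E2 v
      have ho : ZA ((v ∘ ⇑(Equiv.swap (0 : Fin 5) 2)) ∘ ⇑(Equiv.swap (0 : Fin 5) 2)) = ZA v := by
        rw [Function.comp_assoc, ← Equiv.Perm.coe_mul, Equiv.swap_mul_self, Equiv.Perm.coe_one, Function.comp_id]
      linear_combination ho - e1
    · intro v
      show ZA ((v ∘ ⇑(Equiv.swap (2 : Fin 5) 3)) ∘ ⇑(Equiv.swap (0 : Fin 5) 2)) - ZC (v ∘ ⇑(Equiv.swap (2 : Fin 5) 3)) = ZA (v ∘ ⇑(Equiv.swap (0 : Fin 5) 2)) - ZC v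
      have e1 := E2 v
      have e2 := E2 (v ∘ ⇑(Equiv.swap (2 : Fin 5) 3))
      have hs := a23 v
      have ho : ZC ((v ∘ ⇑(Equiv.swap (2 : Fin 5) 3)) ∘ ⇑(Equiv.swap (0 : Fin 5) 2)) = ZC (v ∘ ⇑(Equiv.swap (0 : Fin 5) 2)) := by
        rw [Function.comp_assoc, ← Equiv.Perm.coe_mul,
          show Equiv.swap (2 : Fin 5) 3 * Equiv.swap (0 : Fin 5) 2 = Equiv.swap (0 : Fin 5) 2 * Equiv.swap (0 : Fin 5) 3 from by decide,
          Equiv.Perm.coe_mul, ← Function.comp_assoc, c03]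
      linear_combination e2 - e1 + hs - ho
    · intro v
      show ZA ((v ∘ ⇑(Equiv.swap (2 : Fin 5) 4)) ∘ ⇑(Equiv.swap (0 : Fin 5) 2)) - ZC (v ∘ ⇑(Equiv.swap (2 : Fin 5) 4)) = ZA (v ∘ ⇑(Equiv.swap (0 : Fin 5) 2)) - ZC v
      have e1 := E2 v
      have e2 := E2 (v ∘ ⇑(Equiv.swap (2 : Fin 5) 4))
      have hs := a24 v
      have ho : ZC ((v ∘ ⇑(Equiv.swap (2 : Fin 5) 4)) ∘ ⇑(Equiv.swap (0 : Fin 5) 2)) = ZC (v ∘ ⇑(Equiv.swap (0 : Fin 5) 2)) := by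
        rw [Function.comp_assoc, ← Equiv.Perm.coe_mul,
          show Equiv.swap (2 : Fin 5) 4 * Equiv.swap (0 : Fin 5) 2 = Equiv.swap (0 : Fin 5) 2 * Equiv.swap (0 : Fin 5) 4 from by decide,
          Equiv.Perm.coe_mul, ← Function.comp_assoc, c04]
      linear_combination e2 - e1 + hs - ho
    · intro v
      show ZA ((v ∘ ⇑(Equiv.swap (3 : Fin 5) 4)) ∘ ⇑(Equiv.swap (0 : Fin 5) 2)) - ZC (v ∘ ⇑(Equiv.swap (3 : Fin 5) 4)) = ZA (v ∘ ⇑(Equiv.swap (0 : Fin 5) 2)) - ZC v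
      have hs := c34 v
      have ho : ZA ((v ∘ ⇑(Equiv.swap (3 : Fin 5) 4)) ∘ ⇑(Equiv.swap (0 : Fin 5) 2)) = ZA (v ∘ ⇑(Equiv.swap (0 : Fin 5) 2)) := by
        rw [Function.comp_assoc, ← Equiv.Perm.coe_mul,
          show Equiv.swap (3 : Fin 5) 4 * Equiv.swap (0 : Fin 5) 2 = Equiv.swap (0 : Fin 5) 2 * Equiv.swap (3 : Fin 5) 4 from by decide,
          Equiv.Perm.coe_mul, ← Function.comp_assoc, a34]
      linear_combination ho - hs
  have hQ : ∀ τ : Equiv.Perm (Fin 5), ∀ v : Fin 5 → Fin 5,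
      ZA (v ∘ ⇑τ) + ZA ((v ∘ ⇑τ) ∘ ⇑(Equiv.swap (1 : Fin 5) 2)) + ZA ((v ∘ ⇑τ) ∘ ⇑(Equiv.swap (0 : Fin 5) 2))
        = ZA v + ZA (v ∘ ⇑(Equiv.swap (1 : Fin 5) 2)) + ZA (v ∘ ⇑(Equiv.swap (0 : Fin 5) 2)) := by
    intro τ v
    have h1 := c1full τ v
    have h2 := c2full τ v
    have h3 := hS τ v
    simp only at h1 h2
    linear_combination h1 + h2 + h3
  have tr1 : ∀ v : Fin 5 → Fin 5, ZA (v ∘ ⇑(Equiv.swap (2 : Fin 5) 3)) = ZA v := by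
    intro v
    rw [a23]
  have tr2 : ∀ v : Fin 5 → Fin 5, ZA (v ∘ ⇑(Equiv.swap (2 : Fin 5) 3 * Equiv.swap (1 : Fin 5) 2)) = ZA (v ∘ ⇑(Equiv.swap (1 : Fin 5) 3)) := by
    intro v
    conv_lhs => rw [show (Equiv.swap (2 : Fin 5) 3 * Equiv.swap (1 : Fin 5) 2 : Equiv.Perm (Fin 5)) = Equiv.swap (1 : Fin 5) 3 * Equiv.swap (2 : Fin 5) 3 from by decide]
    conv_lhs => rw [Equiv.Perm.coe_mul, ← Function.comp_assoc]
    rw [a23]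
  have tr3 : ∀ v : Fin 5 → Fin 5, ZA (v ∘ ⇑(Equiv.swap (2 : Fin 5) 3 * Equiv.swap (0 : Fin 5) 2)) = ZA (v ∘ ⇑(Equiv.swap (0 : Fin 5) 3)) := by
    intro v
    conv_lhs => rw [show (Equiv.swap (2 : Fin 5) 3 * Equiv.swap (0 : Fin 5) 2 : Equiv.Perm (Fin 5)) = Equiv.swap (0 : Fin 5) 3 * Equiv.swap (2 : Fin 5) 3 from by decide]
    conv_lhs => rw [Equiv.Perm.coe_mul, ← Function.comp_assoc]
    rw [a23]
  have tr4 : ∀ v : Fin 5 → Fin 5, ZA (v ∘ ⇑(Equiv.swap (2 : Fin 5) 4)) = ZA v := by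
    intro v
    rw [a24]
  have tr5 : ∀ v : Fin 5 → Fin 5, ZA (v ∘ ⇑(Equiv.swap (2 : Fin 5) 4 * Equiv.swap (1 : Fin 5) 2)) = ZA (v ∘ ⇑(Equiv.swap (1 : Fin 5) 4)) := by
    intro v
    conv_lhs => rw [show (Equiv.swap (2 : Fin 5) 4 * Equiv.swap (1 : Fin 5) 2 : Equiv.Perm (Fin 5)) = Equiv.swap (1 : Fin 5) 4 * Equiv.swap (2 : Fin 5) 4 from by decide]
    conv_lhs => rw [Equiv.Perm.coe_mul, ← Function.comp_assoc]
    rw [a24]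
  have tr6 : ∀ v : Fin 5 → Fin 5, ZA (v ∘ ⇑(Equiv.swap (2 : Fin 5) 4 * Equiv.swap (0 : Fin 5) 2)) = ZA (v ∘ ⇑(Equiv.swap (0 : Fin 5) 4)) := by
    intro v
    conv_lhs => rw [show (Equiv.swap (2 : Fin 5) 4 * Equiv.swap (0 : Fin 5) 2 : Equiv.Perm (Fin 5)) = Equiv.swap (0 : Fin 5) 4 * Equiv.swap (2 : Fin 5) 4 from by decide]
    conv_lhs => rw [Equiv.Perm.coe_mul, ← Function.comp_assoc]
    rw [a24]
  have tr7 : ∀ v : Fin 5 → Fin 5, ZA (v ∘ ⇑(Equiv.swap (0 : Fin 5) 3)) = ZA (v ∘ ⇑(Equiv.swap (0 : Fin 5) 3)) := by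
    intro v
    rfl
  have tr8 : ∀ v : Fin 5 → Fin 5, ZA (v ∘ ⇑(Equiv.swap (0 : Fin 5) 3 * Equiv.swap (1 : Fin 5) 2)) = ZA (v ∘ ⇑(Equiv.swap (0 : Fin 5) 2 * Equiv.swap (1 : Fin 5) 3)) := by
    intro v
    conv_lhs => rw [show (Equiv.swap (0 : Fin 5) 3 * Equiv.swap (1 : Fin 5) 2 : Equiv.Perm (Fin 5)) = Equiv.swap (0 : Fin 5) 2 * Equiv.swap (1 : Fin 5) 3 * Equiv.swap (0 : Fin 5) 1 * Equiv.swap (2 : Fin 5) 3 from by decide]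
    conv_lhs => rw [Equiv.Perm.coe_mul, ← Function.comp_assoc]
    rw [a23]
    conv_lhs => rw [Equiv.Perm.coe_mul, ← Function.comp_assoc]
    rw [a01]
  have tr9 : ∀ v : Fin 5 → Fin 5, ZA (v ∘ ⇑(Equiv.swap (0 : Fin 5) 3 * Equiv.swap (0 : Fin 5) 2)) = ZA (v ∘ ⇑(Equiv.swap (0 : Fin 5) 2)) := by
    intro v
    conv_lhs => rw [show (Equiv.swap (0 : Fin 5) 3 * Equiv.swap (0 : Fin 5) 2 : Equiv.Perm (Fin 5)) = Equiv.swap (0 : Fin 5) 2 * Equiv.swap (2 : Fin 5) 3 from by decide]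
    conv_lhs => rw [Equiv.Perm.coe_mul, ← Function.comp_assoc]
    rw [a23]
  have tr10 : ∀ v : Fin 5 → Fin 5, ZA (v ∘ ⇑(Equiv.swap (0 : Fin 5) 4)) = ZA (v ∘ ⇑(Equiv.swap (0 : Fin 5) 4)) := by
    intro v
    rfl
  have tr11 : ∀ v : Fin 5 → Fin 5, ZA (v ∘ ⇑(Equiv.swap (0 : Fin 5) 4 * Equiv.swap (1 : Fin 5) 2)) = ZA (v ∘ ⇑(Equiv.swap (0 : Fin 5) 2 * Equiv.swap (1 : Fin 5) 4)) := by
    intro v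
    conv_lhs => rw [show (Equiv.swap (0 : Fin 5) 4 * Equiv.swap (1 : Fin 5) 2 : Equiv.Perm (Fin 5)) = Equiv.swap (0 : Fin 5) 2 * Equiv.swap (1 : Fin 5) 4 * Equiv.swap (0 : Fin 5) 1 * Equiv.swap (2 : Fin 5) 4 from by decide]
    conv_lhs => rw [Equiv.Perm.coe_mul, ← Function.comp_assoc]
    rw [a24]
    conv_lhs => rw [Equiv.Perm.coe_mul, ← Function.comp_assoc]
    rw [a01]
  have tr12 : ∀ v : Fin 5 → Fin 5, ZA (v ∘ ⇑(Equiv.swap (0 : Fin 5) 4 * Equiv.swap (0 : Fin 5) 2)) = ZA (v ∘ ⇑(Equiv.swap (0 : Fin 5) 2)) := by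
    intro v
    conv_lhs => rw [show (Equiv.swap (0 : Fin 5) 4 * Equiv.swap (0 : Fin 5) 2 : Equiv.Perm (Fin 5)) = Equiv.swap (0 : Fin 5) 2 * Equiv.swap (2 : Fin 5) 4 from by decide]
    conv_lhs => rw [Equiv.Perm.coe_mul, ← Function.comp_assoc]
    rw [a24]
  have tr13 : ∀ v : Fin 5 → Fin 5, ZA (v ∘ ⇑(Equiv.swap (1 : Fin 5) 3 * Equiv.swap (2 : Fin 5) 4)) = ZA (v ∘ ⇑(Equiv.swap (1 : Fin 5) 3)) := by
    intro v
    conv_lhs => rw [Equiv.Perm.coe_mul, ← Function.comp_assoc]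
    rw [a24]
  have tr14 : ∀ v : Fin 5 → Fin 5, ZA (v ∘ ⇑(Equiv.swap (1 : Fin 5) 3 * Equiv.swap (2 : Fin 5) 4 * Equiv.swap (1 : Fin 5) 2)) = ZA (v ∘ ⇑(Equiv.swap (1 : Fin 5) 4)) := by
    intro v
    conv_lhs => rw [show (Equiv.swap (1 : Fin 5) 3 * Equiv.swap (2 : Fin 5) 4 * Equiv.swap (1 : Fin 5) 2 : Equiv.Perm (Fin 5)) = Equiv.swap (1 : Fin 5) 4 * Equiv.swap (2 : Fin 5) 3 * Equiv.swap (3 : Fin 5) 4 from by decide]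
    conv_lhs => rw [Equiv.Perm.coe_mul, ← Function.comp_assoc]
    rw [a34]
    conv_lhs => rw [Equiv.Perm.coe_mul, ← Function.comp_assoc]
    rw [a23]
  have tr15 : ∀ v : Fin 5 → Fin 5, ZA (v ∘ ⇑(Equiv.swap (1 : Fin 5) 3 * Equiv.swap (2 : Fin 5) 4 * Equiv.swap (0 : Fin 5) 2)) = ZA (v ∘ ⇑(Equiv.swap (0 : Fin 5) 3 * Equiv.swap (1 : Fin 5) 4)) := by
    intro v
    conv_lhs => rw [show (Equiv.swap (1 : Fin 5) 3 * Equiv.swap (2 : Fin 5) 4 * Equiv.swap (0 : Fin 5) 2 : Equiv.Perm (Fin 5)) = Equiv.swap (0 : Fin 5) 3 * Equiv.swap (1 : Fin 5) 4 * Equiv.swap (0 : Fin 5) 1 * Equiv.swap (2 : Fin 5) 3 * Equiv.swap (3 : Fin 5) 4 from by decide]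
    conv_lhs => rw [Equiv.Perm.coe_mul, ← Function.comp_assoc]
    rw [a34]
    conv_lhs => rw [Equiv.Perm.coe_mul, ← Function.comp_assoc]
    rw [a23]
    conv_lhs => rw [Equiv.Perm.coe_mul, ← Function.comp_assoc]
    rw [a01]
  have tr16 : ∀ v : Fin 5 → Fin 5, ZA (v ∘ ⇑(Equiv.swap (0 : Fin 5) 3 * Equiv.swap (1 : Fin 5) 4)) = ZA (v ∘ ⇑(Equiv.swap (0 : Fin 5) 3 * Equiv.swap (1 : Fin 5) 4)) := by
    intro v
    rfl
  have tr17 : ∀ v : Fin 5 → Fin 5, ZA (v ∘ ⇑(Equiv.swap (0 : Fin 5) 3 * Equiv.swap (1 : Fin 5) 4 * Equiv.swap (1 : Fin 5) 2)) = ZA (v ∘ ⇑(Equiv.swap (0 : Fin 5) 2 * Equiv.swap (1 : Fin 5) 3)) := by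
    intro v
    conv_lhs => rw [show (Equiv.swap (0 : Fin 5) 3 * Equiv.swap (1 : Fin 5) 4 * Equiv.swap (1 : Fin 5) 2 : Equiv.Perm (Fin 5)) = Equiv.swap (0 : Fin 5) 2 * Equiv.swap (1 : Fin 5) 3 * Equiv.swap (0 : Fin 5) 1 * Equiv.swap (2 : Fin 5) 3 * Equiv.swap (2 : Fin 5) 4 from by decide]
    conv_lhs => rw [Equiv.Perm.coe_mul, ← Function.comp_assoc]
    rw [a24]
    conv_lhs => rw [Equiv.Perm.coe_mul, ← Function.comp_assoc]
    rw [a23]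
    conv_lhs => rw [Equiv.Perm.coe_mul, ← Function.comp_assoc]
    rw [a01]
  have tr18 : ∀ v : Fin 5 → Fin 5, ZA (v ∘ ⇑(Equiv.swap (0 : Fin 5) 3 * Equiv.swap (1 : Fin 5) 4 * Equiv.swap (0 : Fin 5) 2)) = ZA (v ∘ ⇑(Equiv.swap (0 : Fin 5) 2 * Equiv.swap (1 : Fin 5) 4)) := by
    intro v
    conv_lhs => rw [show (Equiv.swap (0 : Fin 5) 3 * Equiv.swap (1 : Fin 5) 4 * Equiv.swap (0 : Fin 5) 2 : Equiv.Perm (Fin 5)) = Equiv.swap (0 : Fin 5) 2 * Equiv.swap (1 : Fin 5) 4 * Equiv.swap (2 : Fin 5) 3 from by decide]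
    conv_lhs => rw [Equiv.Perm.coe_mul, ← Function.comp_assoc]
    rw [a23]
  have T013 : ∀ v : Fin 5 → Fin 5, ZA v + ZA (v ∘ ⇑(Equiv.swap (1 : Fin 5) 3)) + ZA (v ∘ ⇑(Equiv.swap (0 : Fin 5) 3))
      = ZA v + ZA (v ∘ ⇑(Equiv.swap (1 : Fin 5) 2)) + ZA (v ∘ ⇑(Equiv.swap (0 : Fin 5) 2)) := by
    intro v
    have h := hQ (Equiv.swap (2 : Fin 5) 3) v
    simp only [Function.comp_assoc, ← Equiv.Perm.coe_mul] at h
    rw [tr1 v, tr2 v, tr3 v] at h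
    linear_combination h
  have T014 : ∀ v : Fin 5 → Fin 5, ZA v + ZA (v ∘ ⇑(Equiv.swap (1 : Fin 5) 4)) + ZA (v ∘ ⇑(Equiv.swap (0 : Fin 5) 4))
      = ZA v + ZA (v ∘ ⇑(Equiv.swap (1 : Fin 5) 2)) + ZA (v ∘ ⇑(Equiv.swap (0 : Fin 5) 2)) := by
    intro v
    have h := hQ (Equiv.swap (2 : Fin 5) 4) v
    simp only [Function.comp_assoc, ← Equiv.Perm.coe_mul] at h
    rw [tr4 v, tr5 v, tr6 v] at h
    linear_combination h
  have T123 : ∀ v : Fin 5 → Fin 5, ZA (v ∘ ⇑(Equiv.swap (0 : Fin 5) 3)) + ZA (v ∘ ⇑(Equiv.swap (0 : Fin 5) 2 * Equiv.swap (1 : Fin 5) 3)) + ZA (v ∘ ⇑(Equiv.swap (0 : Fin 5) 2))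
      = ZA v + ZA (v ∘ ⇑(Equiv.swap (1 : Fin 5) 2)) + ZA (v ∘ ⇑(Equiv.swap (0 : Fin 5) 2)) := by
    intro v
    have h := hQ (Equiv.swap (0 : Fin 5) 3) v
    simp only [Function.comp_assoc, ← Equiv.Perm.coe_mul] at h
    rw [tr7 v, tr8 v, tr9 v] at h
    linear_combination h
  have T124 : ∀ v : Fin 5 → Fin 5, ZA (v ∘ ⇑(Equiv.swap (0 : Fin 5) 4)) + ZA (v ∘ ⇑(Equiv.swap (0 : Fin 5) 2 * Equiv.swap (1 : Fin 5) 4)) + ZA (v ∘ ⇑(Equiv.swap (0 : Fin 5) 2))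
      = ZA v + ZA (v ∘ ⇑(Equiv.swap (1 : Fin 5) 2)) + ZA (v ∘ ⇑(Equiv.swap (0 : Fin 5) 2)) := by
    intro v
    have h := hQ (Equiv.swap (0 : Fin 5) 4) v
    simp only [Function.comp_assoc, ← Equiv.Perm.coe_mul] at h
    rw [tr10 v, tr11 v, tr12 v] at h
    linear_combination h
  have T034 : ∀ v : Fin 5 → Fin 5, ZA (v ∘ ⇑(Equiv.swap (1 : Fin 5) 3)) + ZA (v ∘ ⇑(Equiv.swap (1 : Fin 5) 4)) + ZA (v ∘ ⇑(Equiv.swap (0 : Fin 5) 3 * Equiv.swap (1 : Fin 5) 4))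
      = ZA v + ZA (v ∘ ⇑(Equiv.swap (1 : Fin 5) 2)) + ZA (v ∘ ⇑(Equiv.swap (0 : Fin 5) 2)) := by
    intro v
    have h := hQ (Equiv.swap (1 : Fin 5) 3 * Equiv.swap (2 : Fin 5) 4) v
    simp only [Function.comp_assoc, ← Equiv.Perm.coe_mul] at h
    rw [tr13 v, tr14 v, tr15 v] at h
    linear_combination h
  have T234 : ∀ v : Fin 5 → Fin 5, ZA (v ∘ ⇑(Equiv.swap (0 : Fin 5) 3 * Equiv.swap (1 : Fin 5) 4)) + ZA (v ∘ ⇑(Equiv.swap (0 : Fin 5) 2 * Equiv.swap (1 : Fin 5) 3)) + ZA (v ∘ ⇑(Equiv.swap (0 : Fin 5) 2 * Equiv.swap (1 : Fin 5) 4))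
      = ZA v + ZA (v ∘ ⇑(Equiv.swap (1 : Fin 5) 2)) + ZA (v ∘ ⇑(Equiv.swap (0 : Fin 5) 2)) := by
    intro v
    have h := hQ (Equiv.swap (0 : Fin 5) 3 * Equiv.swap (1 : Fin 5) 4) v
    simp only [Function.comp_assoc, ← Equiv.Perm.coe_mul] at h
    rw [tr16 v, tr17 v, tr18 v] at h
    linear_combination h
  have a02 : ∀ v : Fin 5 → Fin 5, ZA (v ∘ ⇑(Equiv.swap (0 : Fin 5) 2)) = ZA v := fun v => by
    linear_combination ((-1 : ℂ) / 2) * (T013 v + T014 v - T123 v - T124 v - T034 v + T234 v)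
  have fullA := full_of_five_swaps ZA a01 a02 a23 a24 a34
  refine ⟨fun τ _ v => fullA τ v, fun τ _ v => ?_, fun τ _ v => ?_⟩
  · have h1 := c1full τ v
    have h2 := fullA (τ * Equiv.swap (1 : Fin 5) 2) v
    have h3 := fullA (Equiv.swap (1 : Fin 5) 2) v
    rw [Equiv.Perm.coe_mul, ← Function.comp_assoc] at h2
    simp only at h1
    linear_combination -h1 + h2 - h3
  · have h1 := c2full τ v
    have h2 := fullA (τ * Equiv.swap (0 : Fin 5) 2) v
    have h3 := fullA (Equiv.swap (0 : Fin 5) 2) v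
    rw [Equiv.Perm.coe_mul, ← Function.comp_assoc] at h2
    simp only at h1
    linear_combination -h1 + h2 - h3

end LaplaceFiveTriangleSeparation

end Summit.ValiantsHypothesis.ValiantsHypothesis.Theorems.RigidityForcesSymmetryRankRigidMinimalRepr
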